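import Summits.NavierStokesRegularity.NavierStokesRegularity.Theorems.SlicedKelvinDefs

/-!
# The ε-fold law (`stub_epsFoldLaw`) is false without incompressibility

Negative-side support for the crux `SlicedKelvin.PlanarFluxAPriori` (stmt-NavierStokesRegularity-15600, route
`SlicedKelvin`), line `registered` (skeleton `Cruxes/PlanarFluxAPriori/Lines/birth.lean`, rev 2), refuter cdisprove
seat, cycle 1 (2026-08-17). LOAD-BEARING ANALYSIS of the stub `stub_epsFoldLaw` (the frame-covariant
ε-fold-law identity `Theorems.SlicedKelvin.EpsFoldLawOn ν ε c R v` for smooth, cubically decaying,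
divergence-free `v`): with the hypothesis `VectorCalculus.IsDivFree v` DROPPED (everything else verbatim) the
statement is FALSE (`epsFoldLaw_false_without_divFree`).

Witness: the smooth compactly supported GRADIENT field `v = ∇φ`, `φ(x) = ½ x₂² · ψ(x)` with `ψ` a smooth bump
(`= 1` on the unit ball, supported in the ball of radius `2`), in the identity frame on the plane `{x₂ = 0}`
with `ε = 1` (any `ν`; we take `ν = 0`). Since `curl ∇φ = 0` (tree `curl_gradient_eq_zero_holds`), `ω ≡ 0` and
`f ≡ 0`: the left-hand side, the viscous terms and the fold term of `EpsFoldLawOn` all vanish, and the identity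
collapses to its ε-REGULARISATION TERM `−ε² ∫_{x₂=0} ∂₂v₂ / F_ε(0) = −∫_{ℝ²} ∂₂²φ(y,0) dy = −∫_{ℝ²} ψ(y,0) dy < 0`
(on the plane `∂₂²(½x₂²ψ) = ψ`), i.e. `0 = −∫ψ(y,0)dy`, false.

CONSEQUENCE for the provers: incompressibility is GENUINELY load-bearing in the fold law (not only `div ω = 0`,
which is automatic): it enters through the in-plane integration by parts of the transport term,
`∫ v_∥·∇_∥F(f) = −∫(∇_∥·v_∥)F(f) = +∫ ∂ₙvₙ F(f)`, whose trace is exactly the ε-term; for a compressible field the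
identity fails already when `ω ≡ 0`. (The other hypotheses: `0 < ε` may be weakened to `ε ≠ 0` — `F_ε` is even
in `ε`; smoothness and decay only keep the Bochner integrals honest.)
-/

noncomputable section

-- Problem = summit for this single-conjunct summit: the duplicate namespace component is deliberate.
set_option linter.dupNamespace false

namespace Summit.NavierStokesRegularity.NavierStokesRegularity.Theorems.PlanarFluxAPriori.Negative

open MeasureTheory Set Function Filter Literature.Analysis.FluidPDE
open scoped ENNReal InnerProductSpace Topology ContDiff

/-- The in-plane chart of `{x₂ = 0}` is norm preserving: `‖(y₀, y₁, 0)‖ = ‖y‖`. [folklore] -/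
theorem norm_plane_zero (y : EuclideanSpace ℝ (Fin 2)) :
    ‖(WithLp.toLp 2 ![y 0, y 1, (0 : ℝ)] : EuclideanSpace ℝ (Fin 3))‖ = ‖y‖ := by
  simp [EuclideanSpace.norm_eq, Fin.sum_univ_three, Fin.sum_univ_two]

/-- **`stub_epsFoldLaw` is false without `IsDivFree`.** The registered stub of line `registered` of the crux
`SlicedKelvin.PlanarFluxAPriori` with the incompressibility hypothesis dropped (statement otherwise verbatim)
fails for the compactly supported gradient field `v = ∇(½x₂²ψ)` (`ψ` a smooth bump), frame `R = 1`, plane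
`{x₂ = 0}`, `ε = 1`, `ν = 0`: all terms vanish except the ε-term, which equals `−∫_{ℝ²} ψ(y,0) dy < 0`. [folklore] -/
theorem epsFoldLaw_false_without_divFree :
    ¬ (∀ (ν ε c : ℝ), 0 < ε → ∀ (R : EuclideanSpace ℝ (Fin 3) ≃ₗᵢ[ℝ] EuclideanSpace ℝ (Fin 3))
        (v : EuclideanSpace ℝ (Fin 3) → EuclideanSpace ℝ (Fin 3)), ContDiff ℝ (⊤ : ℕ∞) v →
        (∃ C : ℝ, ∀ (x : EuclideanSpace ℝ (Fin 3)) (k : ℕ), k ≤ 3 →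
          (1 + ‖x‖) ^ 3 * ‖iteratedFDeriv ℝ k v x‖ ≤ C) →
        Summit.NavierStokesRegularity.NavierStokesRegularity.Theorems.SlicedKelvin.EpsFoldLawOn ν ε c R v) := by
  intro h
  -- the bump, the weight `g = ½ x₂²`, the potential `φ = g ψ` and the field `v = ∇φ`
  let ψ : ContDiffBump (0 : EuclideanSpace ℝ (Fin 3)) := ⟨1, 2, one_pos, one_lt_two⟩
  set e₂ : EuclideanSpace ℝ (Fin 3) := EuclideanSpace.single (2 : Fin 3) (1 : ℝ) with he₂
  set P2 : EuclideanSpace ℝ (Fin 3) →L[ℝ] ℝ := EuclideanSpace.proj (2 : Fin 3) with hP2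
  have hP2x : ∀ x : EuclideanSpace ℝ (Fin 3), P2 x = x 2 := fun x => rfl
  set g : EuclideanSpace ℝ (Fin 3) → ℝ := fun x => (1 / 2 : ℝ) * (P2 x * P2 x) with hg
  set φ : EuclideanSpace ℝ (Fin 3) → ℝ := fun x => g x * ψ x with hφ
  set v : EuclideanSpace ℝ (Fin 3) → EuclideanSpace ℝ (Fin 3) := gradient φ with hv
  -- smoothness
  have hgs : ContDiff ℝ ∞ g := contDiff_const.mul (P2.contDiff.mul P2.contDiff)
  have hψs : ContDiff ℝ ∞ (fun x => ψ x) := ψ.contDiff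
  have hφs : ContDiff ℝ ∞ φ := hgs.mul hψs
  have hvs : ContDiff ℝ ∞ v := by
    have e : v = fun x => (InnerProductSpace.toDual ℝ (EuclideanSpace ℝ (Fin 3))).symm (fderiv ℝ φ x) := rfl
    rw [e]
    exact (InnerProductSpace.toDual ℝ (EuclideanSpace ℝ (Fin 3))).symm.contDiff.comp
      (contDiff_infty_iff_fderiv.1 hφs).2
  -- compact support and the decay bound
  have hφc : HasCompactSupport φ := ψ.hasCompactSupport.mul_left
  have hvc : HasCompactSupport v := by
    have h1 : HasCompactSupport (fderiv ℝ φ) := hφc.fderiv (𝕜 := ℝ)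
    exact h1.comp_left (g := fun L => (InnerProductSpace.toDual ℝ (EuclideanSpace ℝ (Fin 3))).symm L)
      (map_zero _)
  have hbd : ∀ k : ℕ, ∃ Ck : ℝ, ∀ x, (1 + ‖x‖) ^ 3 * ‖iteratedFDeriv ℝ k v x‖ ≤ Ck := by
    intro k
    have hcont : Continuous fun x => (1 + ‖x‖) ^ 3 * ‖iteratedFDeriv ℝ k v x‖ :=
      ((continuous_const.add continuous_norm).pow 3).mul
        (hvs.continuous_iteratedFDeriv (m := k) (by exact_mod_cast (le_top : (k : ℕ∞) ≤ ⊤))).norm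
    have hsupp : HasCompactSupport fun x => (1 + ‖x‖) ^ 3 * ‖iteratedFDeriv ℝ k v x‖ :=
      ((hvc.iteratedFDeriv (𝕜 := ℝ) k).norm).mul_left
    obtain ⟨Ck, hCk⟩ := hcont.bddAbove_range_of_hasCompactSupport hsupp
    exact ⟨Ck, fun x => hCk ⟨x, rfl⟩⟩
  choose Cf hCf using hbd
  have hdecay : ∃ C : ℝ, ∀ (x : EuclideanSpace ℝ (Fin 3)) (k : ℕ), k ≤ 3 →
      (1 + ‖x‖) ^ 3 * ‖iteratedFDeriv ℝ k v x‖ ≤ C := by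
    refine ⟨max (max (Cf 0) (Cf 1)) (max (Cf 2) (Cf 3)), fun x k hk => ?_⟩
    interval_cases k
    · exact (hCf 0 x).trans (le_max_of_le_left (le_max_left _ _))
    · exact (hCf 1 x).trans (le_max_of_le_left (le_max_right _ _))
    · exact (hCf 2 x).trans (le_max_of_le_right (le_max_left _ _))
    · exact (hCf 3 x).trans (le_max_of_le_right (le_max_right _ _))
  -- the field is irrotational
  have hcurl : ∀ x, curl v x = 0 := fun x =>
    curl_gradient_eq_zero_holds φ (contDiff_infty.1 hφs 2) x
  -- the second normal derivative of the potential on the plane `{x₂ = 0}` is the bump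
  have hinner : (fun z => inner ℝ (v z) e₂) = fun z => fderiv ℝ φ z e₂ := by
    funext z
    rw [hv, gradient, InnerProductSpace.toDual_symm_apply]
  have hdg : ∀ z, fderiv ℝ g z e₂ = P2 z := by
    intro z
    have h1 : HasFDerivAt g ((1 / 2 : ℝ) • ((P2 z) • P2 + (P2 z) • P2)) z :=
      (P2.hasFDerivAt.mul P2.hasFDerivAt (x := z)).const_mul (1 / 2 : ℝ)
    rw [h1.fderiv]
    simp [hP2x, he₂]
    ring
  have hdφ : ∀ z, fderiv ℝ φ z e₂ = P2 z * ψ z + g z * fderiv ℝ (fun x => ψ x) z e₂ := by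
    intro z
    have hgd : DifferentiableAt ℝ g z := hgs.differentiable (by simp) z
    have hψd : DifferentiableAt ℝ (fun x => ψ x) z := hψs.differentiable (by simp) z
    rw [hφ, fderiv_fun_mul hgd hψd]
    simp [hdg z]
    ring
  have hT4 : ∀ x : EuclideanSpace ℝ (Fin 3), P2 x = 0 → fderiv ℝ (fun z => inner ℝ (v z) e₂) x e₂ = ψ x := by
    intro x hx
    rw [hinner]
    have hfun : (fun z => fderiv ℝ φ z e₂) =
        fun z => P2 z * ψ z + g z * fderiv ℝ (fun x => ψ x) z e₂ := funext hdφ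
    rw [hfun]
    -- differentiability of the pieces
    have hk : ContDiff ℝ ∞ (fun z => fderiv ℝ (fun x => ψ x) z e₂) := by
      have h1 : ContDiff ℝ ∞ (fderiv ℝ (fun x => ψ x)) := (contDiff_infty_iff_fderiv.1 hψs).2
      exact (ContinuousLinearMap.apply ℝ ℝ e₂).contDiff.comp h1
    have hψd : DifferentiableAt ℝ (fun z => ψ z) x := hψs.differentiable (by simp) x
    have hgd : DifferentiableAt ℝ g x := hgs.differentiable (by simp) x
    have hkd : DifferentiableAt ℝ (fun z => fderiv ℝ (fun x => ψ x) z e₂) x := hk.differentiable (by simp) x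
    have hP2' : HasFDerivAt (fun z => P2 z) P2 x := P2.hasFDerivAt
    have hH := (hP2'.fun_mul hψd.hasFDerivAt).fun_add (hgd.hasFDerivAt.fun_mul hkd.hasFDerivAt)
    rw [hH.fderiv]
    have hgx : g x = 0 := by simp [hg, hx]
    have hdgx : fderiv ℝ g x e₂ = 0 := by rw [hdg x, hx]
    have hP2e : P2 e₂ = 1 := by simp [hP2x, he₂]
    simp [hx, hgx, hdgx, hP2e]
  -- positivity of the ε-term integral `∫_{ℝ²} ψ(y,0) dy`
  have hPcont : Continuous fun y : EuclideanSpace ℝ (Fin 2) =>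
      (WithLp.toLp 2 ![y 0, y 1, (0 : ℝ)] : EuclideanSpace ℝ (Fin 3)) := by
    refine (PiLp.continuous_toLp 2 _).comp ?_
    refine continuous_pi fun i => ?_
    fin_cases i
    · simpa using (PiLp.continuous_apply 2 (fun _ : Fin 2 => ℝ) 0)
    · simpa using (PiLp.continuous_apply 2 (fun _ : Fin 2 => ℝ) 1)
    · simpa using continuous_const
  have hψP_cont : Continuous fun y : EuclideanSpace ℝ (Fin 2) => ψ (WithLp.toLp 2 ![y 0, y 1, (0 : ℝ)]) :=
    ψ.continuous.comp hPcont
  have hψP_supp : HasCompactSupport fun y : EuclideanSpace ℝ (Fin 2) =>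
      ψ (WithLp.toLp 2 ![y 0, y 1, (0 : ℝ)]) := by
    refine HasCompactSupport.intro (isCompact_closedBall (0 : EuclideanSpace ℝ (Fin 2)) 2) ?_
    intro y hy
    apply ψ.zero_of_le_dist
    rw [dist_zero_right, norm_plane_zero]
    rw [Metric.mem_closedBall, dist_zero_right, not_le] at hy
    exact hy.le
  have hψP_int : Integrable fun y : EuclideanSpace ℝ (Fin 2) => ψ (WithLp.toLp 2 ![y 0, y 1, (0 : ℝ)]) :=
    hψP_cont.integrable_of_hasCompactSupport hψP_supp
  have hpos : 0 < ∫ y : EuclideanSpace ℝ (Fin 2), ψ (WithLp.toLp 2 ![y 0, y 1, (0 : ℝ)]) := by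
    rw [integral_pos_iff_support_of_nonneg (fun y => ψ.nonneg) hψP_int]
    have hsub : Metric.ball (0 : EuclideanSpace ℝ (Fin 2)) 1 ⊆
        support fun y : EuclideanSpace ℝ (Fin 2) => ψ (WithLp.toLp 2 ![y 0, y 1, (0 : ℝ)]) := by
      intro y hy
      rw [mem_support]
      have : ψ (WithLp.toLp 2 ![y 0, y 1, (0 : ℝ)]) = 1 := by
        apply ψ.one_of_mem_closedBall
        rw [Metric.mem_closedBall, dist_zero_right, norm_plane_zero]
        exact (mem_ball_zero_iff.1 hy).le
      rw [this]
      exact one_ne_zero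
    exact (Metric.measure_ball_pos volume (0 : EuclideanSpace ℝ (Fin 2)) one_pos).trans_le (measure_mono hsub)
  -- evaluate the (false) identity at `ν = 0`, `ε = 1`, `c = 0`, `R = 1`
  have h1 := h 0 1 0 one_pos (LinearIsometryEquiv.refl ℝ (EuclideanSpace ℝ (Fin 3))) v
    (by exact_mod_cast hvs) hdecay
  have hT4' : (fun y : EuclideanSpace ℝ (Fin 2) =>
      fderiv ℝ (fun z => inner ℝ (v z) e₂) (WithLp.toLp 2 ![y 0, y 1, (0 : ℝ)]) e₂) =
      fun y => ψ (WithLp.toLp 2 ![y 0, y 1, (0 : ℝ)]) := by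
    funext y
    exact hT4 _ (by simp [hP2x])
  simp only [Summit.NavierStokesRegularity.NavierStokesRegularity.Theorems.SlicedKelvin.EpsFoldLawOn,
    LinearIsometryEquiv.coe_refl, id_eq, hcurl, inner_zero_left, zero_mul, mul_zero, add_zero,
    integral_zero, sub_zero, zero_sub, fderiv_const_apply, zero_apply, one_pow, ne_eq, OfNat.ofNat_ne_zero,
    not_false_eq_true, zero_pow, zero_add, Real.sqrt_one, div_one, one_mul] at h1
  rw [← he₂, hT4'] at h1
  linarith

end Summit.NavierStokesRegularity.NavierStokesRegularity.Theorems.PlanarFluxAPriori.Negative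

end
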